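import Summits.AnomalousDissipation.AnomalousDissipation.Theorems.QuarticGate.Negative.EnergyRow

/-!
# Negative knowledge for the crux `MomentParity.MomentLadder` (stmt-AnomalousDissipation-11463):
# I — vocabulary, transfer to `QuarticGate`, level ceiling, resolution floor

Certified copy of sections Vocabulary/0/A/B of the cdisprove work file `Cruxes/MomentLadder/Disproof.lean`
(refuter-cdisprove-stmt-AnomalousDissipation-11463-0, cycle 1). Supports stmt-AnomalousDissipation-11463; no
positive route-item statement is asserted (the crux is an `∃`-statement; what is proved here are necessary
conditions on its witnesses and refutations of natural strengthenings).

* `momentLadder_iff` — the crux ↔ its clauses named: the landed `QuarticGate` vocabulary (`IsLevel`,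
  `IsBandTest`, `polyGrad`, `IsPolyStationary`) plus `IsSupported R μ`, `IsResolved κ μ`, bundled as
  `IsLadderWitness f ν N E ε R κ d μ`; by `Iff.rfl`.
* (0) `IsLadderWitness.isQuarticWitness`, `not_momentLadder_of_not_quarticGate` — the `d = 4` rung of a
  ladder witness is a `QuarticGate` witness (bounded support gives the fourth moment): `¬QuarticGate → ¬X`.
* (A) `IsLadderWitness.eps_le_level` (`ε ≤ 4π²N²νE`), `not_isLadderWitness_level_zero`,
  `not_momentLadderBoundedLevel` — the level cannot be chosen before `j`.
* (B) `eGradNormSq_fourierTruncate_le_sq_mul` (Bernstein for `P_K`), `IsResolved.ensembleEnstrophy_le`,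
  `ensembleDissipation_le_of_isResolved`, `IsLadderWitness.eps_le_resolution`
  (`ε ≤ ν(4π²κ(n)²E + 1/(n+1))` for every `n`), `IsLadderWitness.resolution_floor`,
  `eventually_not_isLadderWitness_of_schedule`, `not_momentLadderUniformResolution` — the resolution
  schedule cannot be chosen before `j` (`κ_j(0) ≳ ν_j^{-1/2}`); `IsResolved.mono`, `IsSupported.mono`,
  `IsLadderWitness.mono_d`.
-/

namespace Summit.AnomalousDissipation.AnomalousDissipation.Theorems.MomentLadder.Negative

open MeasureTheory Filter Topology
open scoped ENNReal InnerProductSpace RealInnerProductSpace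
open Literature.Analysis.FunctionSpaces Literature.Analysis.FluidPDE
open Summit.AnomalousDissipation.AnomalousDissipation.Theses.MomentParity
open Summit.AnomalousDissipation.AnomalousDissipation.Theorems.QuarticGate.Negative

noncomputable section

/-! ## Vocabulary (verbatim clauses of `MomentLadder`, named; `IsLevel`, `IsBandTest`, `polyGrad`,
`IsPolyStationary` are the landed ones of `Theorems/QuarticGate/Negative/LevelCeiling.lean`) -/

/-- Support clause of `MomentLadder`: `‖u‖ ≤ R` for `μ`-a.e. `u` (verbatim). -/
def IsSupported (R : ℝ) (μ : Measure (Torus.energySpace (Fin 3))) : Prop :=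
  ∀ᵐ u ∂μ, ‖u‖ ≤ R

/-- Resolution clause of `MomentLadder` (verbatim): the mean enstrophy is carried by the modes
`|k| ≤ κ n` up to `1/(n+1)`, for every `n`. -/
def IsResolved (κ : ℕ → ℕ) (μ : Measure (Torus.energySpace (Fin 3))) : Prop :=
  ∀ n : ℕ, ∫⁻ (u : Torus.energySpace (Fin 3)),
      Torus.eGradNormSq (u.1 : UnitAddTorus (Fin 3) → EuclideanSpace ℝ (Fin 3)) ∂μ ≤
    (∫⁻ (u : Torus.energySpace (Fin 3)),
      Torus.eGradNormSq (Torus.fourierTruncate (κ n)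
        (u.1 : UnitAddTorus (Fin 3) → EuclideanSpace ℝ (Fin 3))) ∂μ) + ((n : ENNReal) + 1)⁻¹

/-- The level-`N`, order-`d` witness clauses of `MomentLadder` at viscosity `ν`, budgets `E`, `ε`,
support radius `R` and resolution schedule `κ` (verbatim body of the crux after `∃ μ`). -/
def IsLadderWitness (f : UnitAddTorus (Fin 3) → EuclideanSpace ℝ (Fin 3)) (ν : ℝ) (N : ℕ)
    (E ε R : ℝ) (κ : ℕ → ℕ) (d : ℕ) (μ : Measure (Torus.energySpace (Fin 3))) : Prop :=
  IsProbabilityMeasure μ ∧ (∀ᵐ u ∂μ, IsLevel N u) ∧ IsSupported R μ ∧ IsResolved κ μ ∧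
    IsPolyStationary ν f N d μ ∧ Torus.ensembleEnergy μ ≤ E ∧ ε ≤ Torus.ensembleDissipation ν μ

/-- `MomentLadder` restated through the vocabulary (definitional unfolding, `Iff.rfl`). -/
theorem momentLadder_iff :
    MomentLadder ↔ ∃ f : UnitAddTorus (Fin 3) → EuclideanSpace ℝ (Fin 3),
      Torus.IsSmooth f ∧ Torus.IsDivFree f ∧ Torus.HasZeroMean f ∧
      ∃ (ν : ℕ → ℝ) (E ε : ℝ), (∀ j, 0 < ν j) ∧ Tendsto ν atTop (𝓝 0) ∧ 0 < ε ∧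
      ∀ j : ℕ, ∃ (R : ℝ) (κ : ℕ → ℕ), ∃ᶠ N in atTop, ∀ d : ℕ, ∃ μ,
        IsLadderWitness f (ν j) N E ε R κ d μ :=
  Iff.rfl

/-! ## 0. Bounded support gives all moments; the `d = 4` rung is a `QuarticGate` witness -/

section Transfer

/-- On a finite measure, an a.e. norm bound gives every moment. [folklore] -/
theorem integrable_norm_pow_of_isSupported {μ : Measure (Torus.energySpace (Fin 3))}
    [IsFiniteMeasure μ] {R : ℝ} (hR : IsSupported R μ) (p : ℕ) :
    Integrable (fun u : Torus.energySpace (Fin 3) => ‖u‖ ^ p) μ := by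
  refine Integrable.mono' (integrable_const ((max R 0) ^ p))
    (continuous_norm.pow p).aestronglyMeasurable (hR.mono fun u hu => ?_)
  rw [Real.norm_eq_abs, abs_of_nonneg (by positivity)]
  exact pow_le_pow_left₀ (norm_nonneg _) (hu.trans (le_max_left _ _)) p

/-- A ladder witness of order `d ≥ 4` is a `QuarticGate` witness (the fourth moment comes from the
support clause). [folklore] -/
theorem IsLadderWitness.isQuarticWitness {f : UnitAddTorus (Fin 3) → EuclideanSpace ℝ (Fin 3)}
    {ν : ℝ} {N : ℕ} {E ε R : ℝ} {κ : ℕ → ℕ} {d : ℕ} {μ : Measure (Torus.energySpace (Fin 3))}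
    (h : IsLadderWitness f ν N E ε R κ d μ) (hd : 4 ≤ d) : IsQuarticWitness f ν N E ε μ := by
  obtain ⟨hprob, hlev, hsupp, -, hstat, hE, hε⟩ := h
  exact ⟨hprob, hlev, integrable_norm_pow_of_isSupported hsupp 4, hstat.mono hd, hE, hε⟩

/-- **`MomentLadder → QuarticGate`** (the `d = 4` rung minus support/resolution): every negative
result on `QuarticGate` transfers. Stated negatively for the Negative lane: -/
theorem not_momentLadder_of_not_quarticGate (h : ¬ QuarticGate) : ¬ MomentLadder := by
  intro hL
  obtain ⟨f, hfs, hfd, hfz, ν, E, ε, hν, hν0, hε, hj⟩ := momentLadder_iff.1 hL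
  refine h (quarticGate_iff.2 ⟨f, hfs, hfd, hfz, ν, E, ε, hν, hν0, hε, fun j => ?_⟩)
  obtain ⟨R, κ, hfreq⟩ := hj j
  exact hfreq.mono fun N hN => by
    obtain ⟨μ, hμ⟩ := hN 4
    exact ⟨μ, hμ.isQuarticWitness le_rfl⟩

end Transfer

/-! ## A. Level ceiling: `ε ≤ 4π²N²ν_jE`; the level cannot be chosen before `j` -/

section Ceiling

/-- **Quantitative level ceiling for ladder witnesses** (any order `d`, stationarity unused):
`ε ≤ 4π² N² ν E`. [folklore] -/
theorem IsLadderWitness.eps_le_level {f : UnitAddTorus (Fin 3) → EuclideanSpace ℝ (Fin 3)}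
    {ν : ℝ} (hν : 0 ≤ ν) {N : ℕ} {E ε R : ℝ} {κ : ℕ → ℕ} {d : ℕ}
    {μ : Measure (Torus.energySpace (Fin 3))} (h : IsLadderWitness f ν N E ε R κ d μ) :
    ε ≤ 4 * Real.pi ^ 2 * (N : ℝ) ^ 2 * ν * E := by
  obtain ⟨hprob, hlev, hsupp, -, -, hEn, hε⟩ := h
  have hdiss := ensembleDissipation_le_of_level hν hlev (integrable_norm_pow_of_isSupported hsupp 2)
  have hE0 : 0 ≤ Torus.ensembleEnergy μ := integral_nonneg fun u => by positivity
  calc ε ≤ Torus.ensembleDissipation ν μ := hε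
    _ ≤ 4 * Real.pi ^ 2 * (N : ℝ) ^ 2 * ν * Torus.ensembleEnergy μ := hdiss
    _ ≤ 4 * Real.pi ^ 2 * (N : ℝ) ^ 2 * ν * E := by gcongr

/-- At level `N = 0` there is no witness with `ε > 0` (the punctured ball is empty, every level-0
field is `0`, the dissipation vanishes). [folklore] -/
theorem not_isLadderWitness_level_zero {f : UnitAddTorus (Fin 3) → EuclideanSpace ℝ (Fin 3)}
    {ν : ℝ} (hν : 0 ≤ ν) {E ε R : ℝ} (hε : 0 < ε) {κ : ℕ → ℕ} {d : ℕ}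
    {μ : Measure (Torus.energySpace (Fin 3))} : ¬ IsLadderWitness f ν 0 E ε R κ d μ := fun h => by
  have := h.eps_le_level hν
  simp at this
  linarith

/-- NATURAL STRENGTHENING 1 (refuted): `MomentLadder` with the Galerkin level `N` chosen BEFORE the
viscosity index `j` (even only frequently in `j`, any support/resolution data). -/
def MomentLadderBoundedLevel : Prop :=
  ∃ f : UnitAddTorus (Fin 3) → EuclideanSpace ℝ (Fin 3),
    Torus.IsSmooth f ∧ Torus.IsDivFree f ∧ Torus.HasZeroMean f ∧
    ∃ (ν : ℕ → ℝ) (E ε : ℝ), (∀ j, 0 < ν j) ∧ Tendsto ν atTop (𝓝 0) ∧ 0 < ε ∧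
    ∃ N : ℕ, ∃ᶠ j in atTop, ∃ (R : ℝ) (κ : ℕ → ℕ), ∀ d : ℕ, ∃ μ,
      IsLadderWitness f (ν j) N E ε R κ d μ

/-- **`¬ MomentLadderBoundedLevel`**: a level-`N` ensemble of energy `≤ E` dissipates
`≤ 4π²N²ν_jE → 0`. Every proof of `MomentLadder` must let `N → ∞` at least like `ν_j^{-1/2}`
inside its `∃ᶠ N`. [folklore] -/
theorem not_momentLadderBoundedLevel : ¬ MomentLadderBoundedLevel := by
  rintro ⟨f, -, -, -, ν, E, ε, hν, hν0, hε, N, hfreq⟩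
  obtain ⟨j, ⟨R, κ, hd⟩, hno⟩ :=
    (hfreq.and_eventually (eventually_not_isQuarticWitness f hν hν0 E hε N)).exists
  obtain ⟨μ, hμ⟩ := hd 4
  exact hno μ (hμ.isQuarticWitness le_rfl)

end Ceiling

/-! ## B. Resolution floor: `ε ≤ ν_j (4π² κ_j(n)² E + 1/(n+1))`; the schedule cannot be uniform in `j` -/

section Resolution

/-- **Bernstein for the truncation** (spectral form, any `L²` class): `‖∇P_K v‖₂² ≤ 4π²K² ‖v‖₂²`
in `ℝ≥0∞`. [folklore] -/
theorem eGradNormSq_fourierTruncate_le_sq_mul (K : ℕ)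
    (v : Lp (EuclideanSpace ℝ (Fin 3)) 2 (volume : Measure (UnitAddTorus (Fin 3)))) :
    Torus.eGradNormSq (Torus.fourierTruncate K (v : UnitAddTorus (Fin 3) → EuclideanSpace ℝ (Fin 3))) ≤
      ENNReal.ofReal (4 * Real.pi ^ 2 * (K : ℝ) ^ 2) * ‖v‖ₑ ^ 2 := by
  have hint : Integrable (v : UnitAddTorus (Fin 3) → EuclideanSpace ℝ (Fin 3)) volume :=
    (Lp.memLp v).integrable one_le_two
  rw [Torus.eGradNormSq_eq_tsum, Torus.enorm_sq_coe_eq_tsum, ← ENNReal.tsum_mul_left,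
    ← ENNReal.tsum_mul_left]
  refine ENNReal.tsum_le_tsum fun k => ?_
  rw [Torus.mFourierCoeff_fourierTruncate hint]
  by_cases hk : k ∈ Torus.freqBall K
  · rw [if_pos hk]
    have hkK : Torus.freqNormSq k ≤ (K : ℝ) ^ 2 := Torus.mem_freqBall.1 hk
    rw [← mul_assoc, ← ENNReal.ofReal_mul (by positivity)]
    gcongr
  · rw [if_neg hk]
    simp

/-- The mean enstrophy of the truncation is bounded by `4π²K²` times the mean energy. [folklore] -/
theorem lintegral_eGradNormSq_fourierTruncate_le (K : ℕ) (μ : Measure (Torus.energySpace (Fin 3))) :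
    ∫⁻ (u : Torus.energySpace (Fin 3)),
        Torus.eGradNormSq (Torus.fourierTruncate K
          (u.1 : UnitAddTorus (Fin 3) → EuclideanSpace ℝ (Fin 3))) ∂μ ≤
      ENNReal.ofReal (4 * Real.pi ^ 2 * (K : ℝ) ^ 2) * ∫⁻ u, ‖u‖ₑ ^ 2 ∂μ := by
  rw [← lintegral_const_mul' _ _ ENNReal.ofReal_ne_top]
  exact lintegral_mono fun u => eGradNormSq_fourierTruncate_le_sq_mul K u.1

/-- **Resolution floor, `ℝ≥0∞` form**: a `κ`-resolved law has
`∫‖∇u‖² dμ ≤ 4π² κ(n)² ∫|u|² dμ + 1/(n+1)` for every `n`. [folklore] -/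
theorem IsResolved.ensembleEnstrophy_le {κ : ℕ → ℕ} {μ : Measure (Torus.energySpace (Fin 3))}
    (h : IsResolved κ μ) (n : ℕ) :
    Torus.ensembleEnstrophy μ ≤
      ENNReal.ofReal (4 * Real.pi ^ 2 * (κ n : ℝ) ^ 2) * (∫⁻ u, ‖u‖ₑ ^ 2 ∂μ) + ((n : ℝ≥0∞) + 1)⁻¹ :=
  (h n).trans (add_le_add (lintegral_eGradNormSq_fourierTruncate_le (κ n) μ) le_rfl)

/-- **Resolution floor for the dissipation**: a `κ`-resolved law with integrable energy has
`ensembleDissipation ν μ ≤ ν (4π² κ(n)² ensembleEnergy μ + 1/(n+1))` for every `n` (`0 ≤ ν`).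
Level and stationarity are NOT used. [folklore] -/
theorem ensembleDissipation_le_of_isResolved {ν : ℝ} (hν : 0 ≤ ν) {κ : ℕ → ℕ}
    {μ : Measure (Torus.energySpace (Fin 3))} (h : IsResolved κ μ)
    (hE : Integrable (fun u : Torus.energySpace (Fin 3) => ‖u‖ ^ 2) μ) (n : ℕ) :
    Torus.ensembleDissipation ν μ ≤
      ν * (4 * Real.pi ^ 2 * (κ n : ℝ) ^ 2 * Torus.ensembleEnergy μ + ((n : ℝ) + 1)⁻¹) := by
  have h1 := h.ensembleEnstrophy_le n
  have h2 : ∫⁻ u, ‖u‖ₑ ^ 2 ∂μ = ENNReal.ofReal (Torus.ensembleEnergy μ) := by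
    rw [Torus.ensembleEnergy, ofReal_integral_eq_lintegral_ofReal hE
      (ae_of_all _ fun u => by positivity)]
    refine lintegral_congr fun u => ?_
    rw [← ofReal_norm, ← ENNReal.ofReal_pow (norm_nonneg _)]
  have h3 : ((n : ℝ≥0∞) + 1)⁻¹ = ENNReal.ofReal (((n : ℝ) + 1)⁻¹) := by
    rw [ENNReal.ofReal_inv_of_pos (by positivity), ENNReal.ofReal_add (by positivity) zero_le_one,
      ENNReal.ofReal_natCast, ENNReal.ofReal_one]
  have hE0 : 0 ≤ Torus.ensembleEnergy μ := integral_nonneg fun u => by positivity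
  rw [h2, h3, ← ENNReal.ofReal_mul (by positivity), ← ENNReal.ofReal_add (by positivity) (by positivity)]
    at h1
  have h4 : (Torus.ensembleEnstrophy μ).toReal ≤
      4 * Real.pi ^ 2 * (κ n : ℝ) ^ 2 * Torus.ensembleEnergy μ + ((n : ℝ) + 1)⁻¹ := by
    have := ENNReal.toReal_mono ENNReal.ofReal_ne_top h1
    rwa [ENNReal.toReal_ofReal (by positivity)] at this
  unfold Torus.ensembleDissipation
  exact mul_le_mul_of_nonneg_left h4 hν

/-- **Quantitative resolution floor for ladder witnesses** (any order `d`; level and stationarity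
unused): `ε ≤ ν (4π² κ(n)² E + 1/(n+1))` for every `n`. Read with `n = 0`: a witness at viscosity
`ν_j` needs `κ_j(0)² ≥ (ε/ν_j − 1)/(4π²E)` — the resolution schedule must degrade at least like
`κ_j ≳ ν_j^{-1/2}` (the Taylor wavenumber), exactly as the level must (`§A`). [folklore] -/
theorem IsLadderWitness.eps_le_resolution {f : UnitAddTorus (Fin 3) → EuclideanSpace ℝ (Fin 3)}
    {ν : ℝ} (hν : 0 ≤ ν) {N : ℕ} {E ε R : ℝ} {κ : ℕ → ℕ} {d : ℕ}
    {μ : Measure (Torus.energySpace (Fin 3))} (h : IsLadderWitness f ν N E ε R κ d μ) (n : ℕ) :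
    ε ≤ ν * (4 * Real.pi ^ 2 * (κ n : ℝ) ^ 2 * E + ((n : ℝ) + 1)⁻¹) := by
  obtain ⟨hprob, -, hsupp, hres, -, hEn, hε⟩ := h
  have hdiss := ensembleDissipation_le_of_isResolved hν hres (integrable_norm_pow_of_isSupported hsupp 2) n
  calc ε ≤ Torus.ensembleDissipation ν μ := hε
    _ ≤ ν * (4 * Real.pi ^ 2 * (κ n : ℝ) ^ 2 * Torus.ensembleEnergy μ + ((n : ℝ) + 1)⁻¹) := hdiss
    _ ≤ ν * (4 * Real.pi ^ 2 * (κ n : ℝ) ^ 2 * E + ((n : ℝ) + 1)⁻¹) := by gcongr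

/-- The same floor solved for the schedule: `ε/ν − 1/(n+1) ≤ 4π² κ(n)² E` (`0 < ν`). [folklore] -/
theorem IsLadderWitness.resolution_floor {f : UnitAddTorus (Fin 3) → EuclideanSpace ℝ (Fin 3)}
    {ν : ℝ} (hν : 0 < ν) {N : ℕ} {E ε R : ℝ} {κ : ℕ → ℕ} {d : ℕ}
    {μ : Measure (Torus.energySpace (Fin 3))} (h : IsLadderWitness f ν N E ε R κ d μ) (n : ℕ) :
    ε / ν - ((n : ℝ) + 1)⁻¹ ≤ 4 * Real.pi ^ 2 * (κ n : ℝ) ^ 2 * E := by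
  have h1 := h.eps_le_resolution hν.le n
  rw [sub_le_iff_le_add, div_le_iff₀ hν]
  linarith

/-- With a FIXED schedule `κ`, witnesses exist for only finitely many `j` along any `ν_j → 0`
(any level, any radius, any order). [folklore] -/
theorem eventually_not_isLadderWitness_of_schedule (f : UnitAddTorus (Fin 3) → EuclideanSpace ℝ (Fin 3))
    {ν : ℕ → ℝ} (hν : ∀ j, 0 < ν j) (hν0 : Tendsto ν atTop (𝓝 0)) (E : ℝ) {ε : ℝ} (hε : 0 < ε)
    (κ : ℕ → ℕ) :
    ∀ᶠ j in atTop, ∀ N R d μ, ¬ IsLadderWitness f (ν j) N E ε R κ d μ := by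
  set C : ℝ := 4 * Real.pi ^ 2 * (κ 0 : ℝ) ^ 2 * max E 0 + 1 + 1 with hC
  have hCpos : 0 < C := by positivity
  have hev : ∀ᶠ j in atTop, ν j < ε / C := (tendsto_order.1 hν0).2 _ (div_pos hε hCpos)
  refine hev.mono fun j hj N R d μ hw => ?_
  have h1 := hw.eps_le_resolution (hν j).le 0
  simp only [Nat.cast_zero, zero_add, inv_one] at h1
  have hmax : 4 * Real.pi ^ 2 * (κ 0 : ℝ) ^ 2 * E ≤ 4 * Real.pi ^ 2 * (κ 0 : ℝ) ^ 2 * max E 0 :=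
    mul_le_mul_of_nonneg_left (le_max_left E 0) (by positivity)
  have h2 : ν j * (4 * Real.pi ^ 2 * (κ 0 : ℝ) ^ 2 * E + 1) ≤ ν j * (C - 1) :=
    mul_le_mul_of_nonneg_left (by rw [hC]; linarith) (hν j).le
  have h3 : ν j * (C - 1) < ε := by
    have := (lt_div_iff₀ hCpos).1 hj
    nlinarith [(hν j).le]
  linarith

/-- NATURAL STRENGTHENING 2 (refuted): `MomentLadder` with the resolution schedule `κ` chosen
BEFORE the viscosity index `j` (uniform-in-`ν` resolution of the dissipation). -/
def MomentLadderUniformResolution : Prop :=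
  ∃ f : UnitAddTorus (Fin 3) → EuclideanSpace ℝ (Fin 3),
    Torus.IsSmooth f ∧ Torus.IsDivFree f ∧ Torus.HasZeroMean f ∧
    ∃ (ν : ℕ → ℝ) (E ε : ℝ), (∀ j, 0 < ν j) ∧ Tendsto ν atTop (𝓝 0) ∧ 0 < ε ∧
    ∃ κ : ℕ → ℕ, ∀ j : ℕ, ∃ R : ℝ, ∃ᶠ N in atTop, ∀ d : ℕ, ∃ μ,
      IsLadderWitness f (ν j) N E ε R κ d μ

/-- **`¬ MomentLadderUniformResolution`**: a law whose enstrophy sits below `κ(0)` up to `1` has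
dissipation `≤ ν_j(4π²κ(0)²E + 1) → 0`. So in `MomentLadder` the order "`∀ j ∃ κ`" is essential: the
dissipation range of any witnessing family moves to infinity as `ν_j → 0` (at least like
`ν_j^{-1/2}`), and the resolution clause only asks that it does so UNIFORMLY IN THE LEVEL `N` at each
fixed `j` — which is the content of the sibling crux `ResolvedDissipation`, not a `ν`-uniform bound.
[folklore] -/
theorem not_momentLadderUniformResolution : ¬ MomentLadderUniformResolution := by
  rintro ⟨f, -, -, -, ν, E, ε, hν, hν0, hε, κ, hj⟩
  obtain ⟨j, hjno⟩ := (eventually_not_isLadderWitness_of_schedule f hν hν0 E hε κ).exists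
  obtain ⟨R, hfreq⟩ := hj j
  obtain ⟨N, hN⟩ := hfreq.exists
  obtain ⟨μ, hμ⟩ := hN 0
  exact hjno N R 0 μ hμ

/-- The truncation enstrophy is monotone in the cutoff. [folklore] -/
theorem eGradNormSq_fourierTruncate_mono {K K' : ℕ} (hK : K ≤ K')
    (v : Lp (EuclideanSpace ℝ (Fin 3)) 2 (volume : Measure (UnitAddTorus (Fin 3)))) :
    Torus.eGradNormSq (Torus.fourierTruncate K (v : UnitAddTorus (Fin 3) → EuclideanSpace ℝ (Fin 3))) ≤
      Torus.eGradNormSq (Torus.fourierTruncate K' (v : UnitAddTorus (Fin 3) → EuclideanSpace ℝ (Fin 3))) := by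
  have hint : Integrable (v : UnitAddTorus (Fin 3) → EuclideanSpace ℝ (Fin 3)) volume :=
    (Lp.memLp v).integrable one_le_two
  rw [Torus.eGradNormSq_eq_tsum, Torus.eGradNormSq_eq_tsum]
  refine mul_le_mul' le_rfl (ENNReal.tsum_le_tsum fun k => ?_)
  rw [Torus.mFourierCoeff_fourierTruncate hint, Torus.mFourierCoeff_fourierTruncate hint]
  by_cases hk : k ∈ Torus.freqBall K
  · rw [if_pos hk, if_pos (Torus.freqBall_mono hK hk)]
  · rw [if_neg hk]
    simp

/-- `IsResolved` is monotone in the schedule: a finer cutoff resolves at least as much. So a prover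
may always enlarge `κ` (e.g. make it increasing, or dominate finitely many schedules). [folklore] -/
theorem IsResolved.mono {κ κ' : ℕ → ℕ} (hκ : ∀ n, κ n ≤ κ' n) {μ : Measure (Torus.energySpace (Fin 3))}
    (h : IsResolved κ μ) : IsResolved κ' μ := fun n =>
  (h n).trans (add_le_add (lintegral_mono fun u => eGradNormSq_fourierTruncate_mono (hκ n) u.1) le_rfl)

/-- `IsSupported` is monotone in the radius. [folklore] -/
theorem IsSupported.mono {R R' : ℝ} (hR : R ≤ R') {μ : Measure (Torus.energySpace (Fin 3))}
    (h : IsSupported R μ) : IsSupported R' μ :=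
  Filter.Eventually.mono h fun _ hu => hu.trans hR

/-- A ladder witness of order `d` is one of every lower order. [folklore] -/
theorem IsLadderWitness.mono_d {f : UnitAddTorus (Fin 3) → EuclideanSpace ℝ (Fin 3)} {ν : ℝ} {N : ℕ}
    {E ε R : ℝ} {κ : ℕ → ℕ} {d d' : ℕ} {μ : Measure (Torus.energySpace (Fin 3))}
    (h : IsLadderWitness f ν N E ε R κ d' μ) (hd : d ≤ d') : IsLadderWitness f ν N E ε R κ d μ := by
  obtain ⟨h1, h2, h3, h4, h5, h6, h7⟩ := h
  exact ⟨h1, h2, h3, h4, h5.mono hd, h6, h7⟩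

end Resolution

end

end Summit.AnomalousDissipation.AnomalousDissipation.Theorems.MomentLadder.Negative
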